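import Literature.NumberTheory.GaloisRepresentations.GlobalReciprocityCharacterFormProofs
import Literature.NumberTheory.GaloisRepresentations.LAdicCharacterUnramifiedAEProofs
import Mathlib.Analysis.Normed.Group.Ultra
import HarnessLib

/-!
# The idele class character `ψ ∘ Art_K` of an `ℓ`-adic Galois character (proved)

Topic `NumberTheory/GaloisRepresentations`; namespace
`Literature.NumberTheory.GaloisRepresentations`.  A *proofs* file (theorems only; no definition,
no named fact, no instance).

For a number field `K` and a continuous character `ψ : Γ_K →ₜ* GL_1(A)` with values in an
ultrametric normed field `A` (the case of interest is `A = ℚ̄_ℓ = PadicAlgCl ℓ`), Böckle–Hui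
(§2.3) and Serre (*Abelian `ℓ`-adic representations*, Ch. III) formulate local algebraicity of
`ψ` through the composite

`ψ ∘ Art_K : 𝔸_Kˣ → 𝔸_Kˣ / Kˣ —Art_K→ Gal_K^ab → A ˣ`

with the Artin reciprocity map `Art_K` (BH §2.3: "`i_ℓ : (K ⊗ ℚ_ℓ)ˣ = ∏_{v ∣ ℓ} K_vˣ → 𝔸_Kˣ/Kˣ
—Art_K→ Gal_K^ab`, where `Art_K` is the Artin reciprocity map … `φ_ℓ` is said to be locally
algebraic if … `φ_ℓ ∘ i_ℓ(x) = r_ℓ(x⁻¹)` for all `x` close enough to `1`").  This file constructs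
that composite from the tree's (now unconditional) global reciprocity law and records its defining
properties, in the vocabulary of the named fact `exists_heckeCharacter_of_weaklyDivides`
(`WeakAbelianDirectSummand.lean`):

* **`FramedGaloisRep.exists_idelicCharacter`** — there is a continuous character
  `Ψ : 𝕀_K →ₜ* Aˣ`, trivial on the principal ideles `Kˣ`, such that at every finite place `v` at
  which `ψ` is unramified, `Ψ` kills the local units `⟨𝒪_vˣ⟩_v` and `Ψ(⟨ϖ⟩_v) = ψ(Frob_v)` for
  every `ϖ ∈ K_v` of valuation one and every arithmetic Frobenius `Frob_v ∈ Γ_K` above `v`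
  (stated as `ψ.HasFrobCharpolyAt v (X - C (Ψ ⟨ϖ⟩_v))`).  Here `Ψ = ψ^ab ∘ ( , K) ∘ (𝕀_K → C_K)` for
  the universal norm residue symbol `( , K) = lim_L ψ_{L|K} : C_K → Γ_K^ab` of the tree
  (`IsCompatibleSystem.theta` of the Artin maps `artinMapFamily`, Tate, Cassels–Fröhlich VII §5;
  `artinReciprocity_character_holds`), and `ψ^ab : Γ_K^ab → Aˣ` the factorisation of the abelian
  character `det ∘ ψ = ψ₀₀` through `Γ_K^ab = Γ_K ⧸ closure [Γ_K, Γ_K]`.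
* **`FramedGaloisRep.exists_idelicCharacter_eventually`** — for `A = ℚ̄_ℓ`, the same `Ψ` has
  these two local properties at all but finitely many `v` (the tree's
  `FramedGaloisRep.eventually_isUnramifiedAt_of_rank_one`).

The one non-formal point is the Frobenius property.  The tree's `( , K)` is characterised by its
restrictions to the finite abelian `L ⊆ K̄` (`IsCompatibleSystem.Reps`), and the Artin map
`ψ_{L|K}` sends the prime idele `⟨ϖ⟩_v` to `Frob_v ∈ G(L|K)` when `v` is unramified in `L`
(`artinIdeleMap_localUnits_of_valuation_eq`, Tate VII 4.2 (iii)).  We use the finite abelian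
extensions `L_r` cut out by the open subgroups `ψ⁻¹(U_r)`, `U_r = {u : ‖u - 1‖ < r}` the one-units
of level `r` of `A` (`exists_subgroup_units_norm_sub_one_lt`;
`absoluteGaloisGroup.exists_isAbelianGalois_fixingSubgroup_eq`): if `ψ` is unramified at `v`, all
inertia groups of `Γ_K` above `v` die in `G(L_r|K)`, so `v` is unramified in `L_r` (contrapositive
of the tree's `exists_mem_inertia_absRestrictNormalHom_ne_one`, Serre, *Local Fields* I §7
Prop. 22 (b)), a representative `γ` of `(⟨ϖ⟩_v, K)` agrees with `Frob_v` on `L_r`, hence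
`ψ(γ) ψ(Frob_v)⁻¹ ∈ U_r`; as `r` is arbitrary, `ψ(γ) = ψ(Frob_v)` (`det_eq_of_forall_artinIdeleMap_eq`).

## References

* G. Böckle, C.-Y. Hui, *Weak abelian direct summands and irreducibility of Galois
  representations*, Math. Ann. 393 (2025), §2.3 (the maps `i_ℓ`, `Art_K`, local algebraicity).
  [BockleHui2025]
* J. Tate, *Global class field theory*, Ch. VII of Cassels–Fröhlich, *Algebraic Number Theory*
  (1967), §4.2 Corollary (iii), §5.1, 5.4–5.6 (`ψ_K = lim ψ_{L/K}`). [CasselsFrohlichANT1967]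
* J.-P. Serre, *Abelian ℓ-adic representations and elliptic curves* (1968), Ch. III §1–§2
  (locally algebraic abelian representations via `C_K → Γ_K^ab`). [SerreAbelianLadic1968]
* J.-P. Serre, *Local Fields* (1979), Ch. I §7 Prop. 22. [SerreLocalFields1979]
-/

noncomputable section

open scoped NumberField Polynomial Topology
open NumberField IsDedekindDomain IsDedekindDomain.HeightOneSpectrum Field Polynomial Filter

namespace Literature.NumberTheory.GaloisRepresentations

variable {K : Type} [Field K] [NumberField K]

/-! ### The Artin map at a prime all of whose inertia dies in `G(L|K)` -/

section ArtinFrobenius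

variable (L : IntermediateField K (AlgebraicClosure K)) [FiniteDimensional K L] [NumberField L]

omit [FiniteDimensional K L] in
/-- **If every inertia group of `Γ_K` above `v` dies in `G(L|K)`, then `v` is unramified in `L`**
(contrapositive of `exists_mem_inertia_absRestrictNormalHom_ne_one`: at a ramified `v` some
inertia element survives, Serre, *Local Fields* I §7 Prop. 22 (b)). [cite: SerreLocalFields1979, Ch. I §7 Prop. 22(b)] -/
theorem isUnramifiedIn_of_forall_inertia_absRestrictNormalHom_eq_one [IsGalois K L]
    {v : HeightOneSpectrum (𝓞 K)}
    (hI : ∀ 𝔓 ∈ v.primesAbove, ∀ σ ∈ 𝔓.inertia (absoluteGaloisGroup K),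
      absRestrictNormalHom L σ = 1) :
    Algebra.IsUnramifiedIn (𝓞 L) v.asIdeal := by
  by_contra hram
  obtain ⟨𝔓, h𝔓, g, hg, hne⟩ := exists_mem_inertia_absRestrictNormalHom_ne_one L hram
  exact hne (hI 𝔓 h𝔓 g hg)

variable [IsAbelianGalois K L]

/-- **`ψ_{L|K}(⟨ϖ⟩_v) = Frob_v|_L` for ANY arithmetic Frobenius `Frob_v ∈ Γ_K` above `v`**, at a
prime `v` all of whose inertia groups die in `G(L|K)` and for every `ϖ ∈ K_v` of valuation one
(Tate VII 4.2 (iii), `artinIdeleMap_localUnits_of_valuation_eq`, combined with "Frobenius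
restricts to Frobenius", `isArithFrobAt_absRestrictNormalHom`, and the uniqueness of the
Frobenius element of the abelian `G(L|K)`, `eq_galFrob`).
[cite: CasselsFrohlichANT1967, Ch. VII §4.2 Corollary (iii)] -/
theorem artinIdeleMap_localUnits_eq_absRestrictNormalHom (hR : artinReciprocity_character)
    {v : HeightOneSpectrum (𝓞 K)}
    (hI : ∀ 𝔓 ∈ v.primesAbove, ∀ σ ∈ 𝔓.inertia (absoluteGaloisGroup K),
      absRestrictNormalHom L σ = 1)
    {ϖ : (v.adicCompletion K)ˣ} (hϖ : Valued.v (ϖ : v.adicCompletion K) = WithZero.exp (-1 : ℤ))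
    {𝔓 : Ideal (absIntegers (𝓞 K) K)} (h𝔓 : 𝔓 ∈ v.primesAbove) {Φ : absoluteGaloisGroup K}
    (hΦ : IsArithFrobAt (𝓞 K) Φ 𝔓) :
    artinIdeleMap L hR (localUnits v ϖ) = absRestrictNormalHom L Φ := by
  have hunr := isUnramifiedIn_of_forall_inertia_absRestrictNormalHom_eq_one L hI
  haveI : 𝔓.IsPrime := h𝔓.1
  rw [artinIdeleMap_localUnits_of_valuation_eq L hR hunr hϖ]
  exact (eq_galFrob (commute_of_isAbelianGalois L) hunr
    (comap_ringOfIntegersToIntegralClosure_mem_primesOver_of_mem_primesAbove L h𝔓)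
    (isArithFrobAt_absRestrictNormalHom L hΦ)).symm

/-- **`ψ_{L|K}(⟨u⟩_v) = 1` for `u ∈ 𝒪_vˣ`** at a prime `v` all of whose inertia groups die in
`G(L|K)` (Tate VII 4.2 (iii), `artinIdeleMap_localUnits_integer`).
[cite: CasselsFrohlichANT1967, Ch. VII §4.2 Corollary (iii)] -/
theorem artinIdeleMap_localUnits_integer_of_forall_inertia (hR : artinReciprocity_character)
    {v : HeightOneSpectrum (𝓞 K)}
    (hI : ∀ 𝔓 ∈ v.primesAbove, ∀ σ ∈ 𝔓.inertia (absoluteGaloisGroup K),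
      absRestrictNormalHom L σ = 1)
    (u : (v.adicCompletionIntegers K)ˣ) :
    artinIdeleMap L hR
        (localUnits v (Units.map ((v.adicCompletionIntegers K).subtype : _ →* _) u)) = 1 :=
  artinIdeleMap_localUnits_integer L hR
    (isUnramifiedIn_of_forall_inertia_absRestrictNormalHom_eq_one L hI) u

end ArtinFrobenius

/-! ### Continuity of `( , K)` -/

/-- **The universal norm residue symbol `( , K) = lim ψ_{L|K} : C_K → Γ_K^ab` is continuous**
(Neukirch, Bonn Lectures III (7.12); here from the open kernels alone, the tree's
`isOpen_ker_artinMapFamily` and `IsCompatibleSystem.continuous_theta`). [cite: Neukirch2013, Part III Thm. (7.12), p. 182] -/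
theorem continuous_theta_artinMapFamily (hR : artinReciprocity_character) :
    Continuous (isCompatibleSystem_artinMapFamily (K := K) hR).theta :=
  (isCompatibleSystem_artinMapFamily hR).continuous_theta fun L _ _ =>
    isOpen_ker_artinMapFamily hR L

/-! ### The idele class character of an abelian `A`-valued character of `Γ_K` -/

section IdelicCharacter

variable {A : Type*} [NormedField A] [IsUltrametricDist A]

omit [IsUltrametricDist A] in
/-- In a normed field, an element `a` with `‖a - 1‖ < r` for every `0 < r ≤ 1` is `1`. [folklore] -/
theorem eq_one_of_forall_norm_sub_one_lt {a : A}
    (h : ∀ r : ℝ, 0 < r → r ≤ 1 → ‖a - 1‖ < r) : a = 1 := by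
  by_contra hne
  have hpos : 0 < ‖a - 1‖ := norm_pos_iff.mpr (sub_ne_zero.mpr hne)
  have h1 := h (min ‖a - 1‖ 1) (lt_min hpos one_pos) (min_le_right _ _)
  exact absurd (h1.trans_le (min_le_left _ _)) (lt_irrefl _)

omit [NumberField K] [IsUltrametricDist A] in
/-- For a rank-one framed representation, `det (ψ σ) = ψ(σ)₀₀` in `A`. [folklore] -/
theorem FramedGaloisRep.coe_det_apply_of_rank_one (ψ : FramedGaloisRep K A 1)
    (σ : absoluteGaloisGroup K) :
    ((FramedRep.det ψ σ : Aˣ) : A) = ((ψ σ : GL (Fin 1) A) : Matrix (Fin 1) (Fin 1) A) 0 0 := by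
  rw [FramedRep.det_apply, Matrix.GeneralLinearGroup.val_det_apply, Matrix.det_fin_one]

/-- **The rigidity step.**  Let `ψ : Γ_K →ₜ* GL_1(A)` (`A` an ultrametric normed field), `x ∈ 𝕀_K`,
`γ ∈ Γ_K` a representative of `(x, K) ∈ Γ_K^ab` (`IsCompatibleSystem.Reps`), and `δ ∈ Γ_K` such
that `ψ_{L|K}(x) = δ|_L` for every finite abelian `L ⊆ K̄` on which `ker ψ` acts trivially.  Then
`det ψ(γ) = det ψ(δ)`: for every level `0 < r ≤ 1` the finite abelian `L_r` cut out by the open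
subgroup `ψ⁻¹(U_r)`, `U_r = {u : ‖u - 1‖ < r}`, qualifies, so `γ δ⁻¹` fixes `L_r`, i.e.
`det ψ(γ) det ψ(δ)⁻¹ ∈ U_r`. [cite: BockleHui2025, §2.3] -/
theorem FramedGaloisRep.det_eq_of_forall_artinIdeleMap_eq (hR : artinReciprocity_character)
    (ψ : FramedGaloisRep K A 1) {x : ideleGroup K} {γ δ : absoluteGaloisGroup K}
    (hγ : γ ∈ (isCompatibleSystem_artinMapFamily (K := K) hR).Reps (QuotientGroup.mk x))
    (hδ : ∀ (L : IntermediateField K (AlgebraicClosure K)) [FiniteDimensional K L] [NumberField L]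
      [IsAbelianGalois K L],
      (∀ σ : absoluteGaloisGroup K, ψ σ = 1 → absRestrictNormalHom L σ = 1) →
      artinIdeleMap L hR x = absRestrictNormalHom L δ) :
    FramedRep.det ψ γ = FramedRep.det ψ δ := by
  classical
  set χ : absoluteGaloisGroup K →ₜ* Aˣ := FramedRep.det ψ with hχdef
  -- it suffices that `χ γ (χ δ)⁻¹` is a one-unit of every level
  suffices hmain : ∀ r : ℝ, 0 < r → r ≤ 1 →
      ‖(((χ γ * (χ δ)⁻¹ : Aˣ)) : A) - 1‖ < r by
    have h1 : (((χ γ * (χ δ)⁻¹ : Aˣ)) : A) = 1 := eq_one_of_forall_norm_sub_one_lt hmain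
    have h2 : χ γ * (χ δ)⁻¹ = 1 := Units.ext (by rw [h1, Units.val_one])
    exact mul_inv_eq_one.mp h2
  intro r hr0 hr1
  obtain ⟨U, hU, hUo⟩ := exists_subgroup_units_norm_sub_one_lt (L := A) hr0 hr1
  set N : Subgroup (absoluteGaloisGroup K) := U.comap χ.toMonoidHom with hNdef
  have hNo : IsOpen (N : Set (absoluteGaloisGroup K)) := hUo.preimage χ.continuous
  have hcomm : ∀ a b : absoluteGaloisGroup K, a * b * a⁻¹ * b⁻¹ ∈ N := fun a b => by
    rw [hNdef, Subgroup.mem_comap]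
    have h1 : χ.toMonoidHom (a * b * a⁻¹ * b⁻¹) = 1 := by
      rw [map_mul, map_mul, map_mul, map_inv, map_inv, mul_comm (χ.toMonoidHom a),
        mul_inv_cancel_right, mul_inv_cancel]
    rw [h1]
    exact U.one_mem
  obtain ⟨L, hLfd, hLab, hLfix⟩ :=
    absoluteGaloisGroup.exists_isAbelianGalois_fixingSubgroup_eq K N hNo hcomm
  haveI := hLfd
  haveI := hLab
  haveI : NumberField L := NumberField.of_module_finite K L
  -- membership in `N` is being fixed on `L`
  have hmemN : ∀ σ : absoluteGaloisGroup K, absRestrictNormalHom L σ = 1 ↔ σ ∈ N := fun σ => by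
    rw [absRestrictNormalHom_eq_one_iff, hLfix]
    rfl
  -- `ker ψ` fixes `L`
  have hL : ∀ σ : absoluteGaloisGroup K, ψ σ = 1 → absRestrictNormalHom L σ = 1 := fun σ hσ => by
    rw [hmemN, hNdef, Subgroup.mem_comap, hU]
    have h1 : χ.toMonoidHom σ = 1 := by
      change FramedRep.det ψ σ = 1
      rw [FramedRep.det_apply, hσ, map_one]
    rw [h1, Units.val_one, sub_self, norm_zero]
    exact hr0
  -- `γ` and `δ` agree on `L`
  have h1 : absRestrictNormalHom L γ = absRestrictNormalHom L δ := by
    have h2 := hγ L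
    rw [artinMapFamily_eq, artinClassMap_mk, hδ L hL] at h2
    exact h2
  have h2 : absRestrictNormalHom L (δ⁻¹ * γ) = 1 := by
    rw [map_mul, map_inv, h1, inv_mul_cancel]
  rw [hmemN, hNdef, Subgroup.mem_comap, hU] at h2
  have h3 : χ.toMonoidHom (δ⁻¹ * γ) = χ γ * (χ δ)⁻¹ := by
    rw [map_mul, map_inv, mul_comm]
    rfl
  rw [h3] at h2
  exact h2

/-- **The idele class character `Ψ = ψ ∘ Art_K` of an abelian character `ψ : Γ_K → GL_1(A)`**
(`A` an ultrametric normed field, e.g. `ℚ̄_ℓ`).  There is a continuous character `Ψ : 𝕀_K →ₜ* Aˣ`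
with

* `Ψ(Kˣ) = 1` (it factors through the idele class group `C_K = 𝕀_K / Kˣ`), and
* at every finite place `v` at which `ψ` is unramified: `Ψ(⟨u⟩_v) = 1` for `u ∈ 𝒪_vˣ`, and
  `ψ(Frob_v) = Ψ(⟨ϖ⟩_v)` for every `ϖ ∈ K_v` of valuation one and every arithmetic Frobenius
  `Frob_v ∈ Γ_K` above `v`, i.e. `ψ.HasFrobCharpolyAt v (X - C (Ψ ⟨ϖ⟩_v))`,

namely `Ψ = ψ^ab ∘ ( , K) ∘ (𝕀_K → C_K)` for the universal norm residue symbol `( , K) : C_K → Γ_K^ab`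
of global class field theory (the tree's theorem: `artinReciprocity_character_holds`,
`IsCompatibleSystem.theta`) and the factorisation `ψ^ab` of `det ∘ ψ` through `Γ_K^ab`.  This is
the composite `φ_ℓ ∘ Art_K` of BH §2.3 / Serre Ch. III, through which local algebraicity of `ψ`
is defined. [cite: BockleHui2025, §2.3] [cite: CasselsFrohlichANT1967, Ch. VII §4.2 Corollary, §5.1 and 5.4–5.6] -/
theorem FramedGaloisRep.exists_idelicCharacter (ψ : FramedGaloisRep K A 1) :
    ∃ Ψ : ideleGroup K →ₜ* Aˣ,
      (∀ x ∈ principalIdeles K, Ψ x = 1) ∧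
      ∀ v : HeightOneSpectrum (𝓞 K), ψ.IsUnramifiedAt v →
        (∀ u : (v.adicCompletionIntegers K)ˣ,
            Ψ (localUnits v (Units.map ((v.adicCompletionIntegers K).subtype : _ →* _) u)) = 1) ∧
        ∀ ϖ : (v.adicCompletion K)ˣ,
          Valued.v (ϖ : v.adicCompletion K) = WithZero.exp (-1 : ℤ) →
            ψ.HasFrobCharpolyAt v (X - C ((Ψ (localUnits v ϖ) : Aˣ) : A)) := by
  classical
  set hR : artinReciprocity_character := artinReciprocity_character_holds with hRdef
  set χ : absoluteGaloisGroup K →ₜ* Aˣ := FramedRep.det ψ with hχdef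
  -- `χ` factors through `Γ_K^ab = Γ_K ⧸ closure [Γ_K, Γ_K]`
  have hC : (commutator (absoluteGaloisGroup K)).topologicalClosure ≤ χ.toMonoidHom.ker := by
    refine Subgroup.topologicalClosure_minimal _ (Abelianization.commutator_subset_ker _) ?_
    rw [MonoidHom.coe_ker]
    exact isClosed_singleton.preimage χ.continuous
  set χab : absoluteGaloisGroupAbelianization K →* Aˣ :=
    QuotientGroup.lift (commutator (absoluteGaloisGroup K)).topologicalClosure χ.toMonoidHom hC
    with hχabdef
  have hχab : ∀ γ : absoluteGaloisGroup K, χab (absGaloisAbProj K γ) = χ γ := fun γ => rfl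
  have hχabc : Continuous χab := by
    rw [(QuotientGroup.isQuotientMap_mk
      (commutator (absoluteGaloisGroup K)).topologicalClosure).continuous_iff]
    exact χ.continuous
  -- the universal norm residue symbol
  set hω := isCompatibleSystem_artinMapFamily (K := K) hR with hωdef
  have hθc : Continuous hω.theta := continuous_theta_artinMapFamily hR
  -- the character `Ψ`
  set Ψ₀ : ideleGroup K →* Aˣ :=
    χab.comp (hω.theta.comp (QuotientGroup.mk' (principalIdeles K))) with hΨ₀def
  have hΨ₀c : Continuous Ψ₀ :=
    hχabc.comp (hθc.comp (QuotientGroup.continuous_mk (N := principalIdeles K)))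
  set Ψ : ideleGroup K →ₜ* Aˣ := ⟨Ψ₀, hΨ₀c⟩ with hΨdef
  have hΨapply : ∀ x : ideleGroup K, Ψ x = χab (hω.theta (QuotientGroup.mk x)) := fun x => rfl
  -- evaluation through representatives
  have hΨrep : ∀ x : ideleGroup K, ∃ γ : absoluteGaloisGroup K,
      Ψ x = χ γ ∧ γ ∈ hω.Reps (QuotientGroup.mk x) := fun x => by
    obtain ⟨γ, hγ, hγr⟩ := hω.exists_absGaloisAbProj_eq_theta (QuotientGroup.mk x)
    refine ⟨γ, ?_, hγr⟩
    rw [hΨapply, ← hγ, hχab]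
  refine ⟨Ψ, fun x hx => ?_, fun v hv => ?_⟩
  · rw [hΨapply, (QuotientGroup.eq_one_iff x).mpr hx, map_one, map_one]
  · -- at `v` unramified for `ψ`, all inertia above `v` dies wherever `ker ψ` does
    have hI : ∀ (L : IntermediateField K (AlgebraicClosure K)) [FiniteDimensional K L]
        [IsAbelianGalois K L],
        (∀ σ : absoluteGaloisGroup K, ψ σ = 1 → absRestrictNormalHom L σ = 1) →
        ∀ 𝔓 ∈ v.primesAbove, ∀ σ ∈ 𝔓.inertia (absoluteGaloisGroup K),
          absRestrictNormalHom L σ = 1 :=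
      fun L _ _ hL 𝔓 h𝔓 σ hσ => hL σ (hv 𝔓 h𝔓 σ hσ)
    refine ⟨fun u => ?_, fun ϖ hϖ => ?_⟩
    · obtain ⟨γ, hΨγ, hγr⟩ :=
        hΨrep (localUnits v (Units.map ((v.adicCompletionIntegers K).subtype : _ →* _) u))
      have h1 : χ γ = χ 1 :=
        FramedGaloisRep.det_eq_of_forall_artinIdeleMap_eq hR ψ hγr fun L _ _ _ hL => by
          rw [map_one]
          exact artinIdeleMap_localUnits_integer_of_forall_inertia L hR (hI L hL) u
      rw [hΨγ, h1, map_one]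
    · obtain ⟨γ, hΨγ, hγr⟩ := hΨrep (localUnits v ϖ)
      refine (FramedGaloisRep.hasFrobCharpolyAt_iff_of_rank_one ψ v _).mpr fun 𝔓 h𝔓 Φ hΦ => ?_
      have h1 : χ γ = χ Φ :=
        FramedGaloisRep.det_eq_of_forall_artinIdeleMap_eq hR ψ hγr fun L _ _ _ hL =>
          artinIdeleMap_localUnits_eq_absRestrictNormalHom L hR (hI L hL) hϖ h𝔓 hΦ
      rw [hΨγ, h1, hχdef, FramedGaloisRep.coe_det_apply_of_rank_one]

end IdelicCharacter

/-! ### The `ℓ`-adic case: the local description holds at almost all places -/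

section Padic

variable {ℓ : ℕ} [Fact ℓ.Prime]

/-- **The idele class character of an `ℓ`-adic character, almost everywhere form.**  For a
continuous `ψ : Γ_K →ₜ* GL_1(ℚ̄_ℓ)` there is a continuous `Ψ : 𝕀_K →ₜ* ℚ̄_ℓˣ` trivial on `Kˣ` such
that for all but finitely many finite places `v`: `ψ` is unramified at `v`, `Ψ(⟨𝒪_vˣ⟩_v) = 1`, and
`ψ(Frob_v) = Ψ(⟨ϖ⟩_v)` for every `ϖ` of valuation one (every `ℓ`-adic character is unramified
almost everywhere, `FramedGaloisRep.eventually_isUnramifiedAt_of_rank_one`).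
[cite: BockleHui2025, §2.3] [cite: SerreAbelianLadic1968, Ch. III §2] -/
theorem FramedGaloisRep.exists_idelicCharacter_eventually
    (ψ : FramedGaloisRep K (PadicAlgCl ℓ) 1) :
    ∃ Ψ : ideleGroup K →ₜ* (PadicAlgCl ℓ)ˣ,
      (∀ x ∈ principalIdeles K, Ψ x = 1) ∧
      ∀ᶠ v : HeightOneSpectrum (𝓞 K) in cofinite,
        ψ.IsUnramifiedAt v ∧
        (∀ u : (v.adicCompletionIntegers K)ˣ,
            Ψ (localUnits v (Units.map ((v.adicCompletionIntegers K).subtype : _ →* _) u)) = 1) ∧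
        ∀ ϖ : (v.adicCompletion K)ˣ,
          Valued.v (ϖ : v.adicCompletion K) = WithZero.exp (-1 : ℤ) →
            ψ.HasFrobCharpolyAt v
              (X - C ((Ψ (localUnits v ϖ) : (PadicAlgCl ℓ)ˣ) : PadicAlgCl ℓ)) := by
  obtain ⟨Ψ, hK, hloc⟩ := ψ.exists_idelicCharacter
  exact ⟨Ψ, hK, (ψ.eventually_isUnramifiedAt_of_rank_one).mono fun v hv => ⟨hv, hloc v hv⟩⟩

end Padic

end Literature.NumberTheory.GaloisRepresentations

end
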